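import Summits.BirchSwinnertonDyer.BirchSwinnertonDyer.Theorems.TwoAdicConverseOrdLambdaHalfAtTwoThetaSupplyOfPrint
import Literature.NumberTheory.EllipticCurves.Kato2004.TateModuleFilAtInertiaProofs
import Literature.NumberTheory.EllipticCurves.Sprung2012.SharpFlatSelmerDualRestrictionProofs
import Literature.NumberTheory.EllipticCurves.IwasawaAlgebraMuAdditiveProofs
import HarnessLib

/-!
# Route `TwoAdicConverse` (rung S3), crux `OrdLambdaHalfAtTwo` (item stmt-BirchSwinnertonDyer-19556), line
# `kato_determinant_greenberg_two` (skeleton v4.8): the print binder «X₀-torsion» of stub 4‴ is REDUNDANT —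
# `X₀(E/ℚ_∞)`, `X₀(E^K/ℚ_∞)` are `Λ`-torsion ON THE HABITAT from PUB (Kato 17.4 at `2`) by the kernel surjection `X ↠ X₀`

Cell `bsd-2adic`, seat `bsd-2adic-conv-1` GEN 33 (`--supports stmt-BirchSwinnertonDyer-19556 --as helper`; the LEAD closes registered
stubs).  Up to GEN 32 the registered construction stub 4‴ `ThetaShapiroKatoGreenbergSupplyAtTwo` was derived
(`TwoAdicShapiroPT.thetaShapiroKatoGreenbergSupplyAtTwo_of_print'`, p709423) from SIX printed named facts
{PUB, F3-K, (12.2.3), X₀-torsion, Kato 12.4, PT-K} (+ the kernel theorems ORD `Kato2004.tateModuleFilAt_inertia_ordinary_holds` and (S)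
`lambdaShapiroFineAtTwo_holds`).  The input «X₀-torsion» = `Kato2004_fineSelmerDual_isTorsion` (Kato Thm 12.4 (1) ∘ (17.13.1): `X₀(E/ℚ_∞)`
is `Λ`-torsion for EVERY `E/ℚ` and every `p`) is consumed by the assembly `TwoAdicThetaSupply.thetaShapiroKatoGreenbergSupplyAtTwo_of_inputs`
(p701530) ONLY for the two curves of the line — `W` (good ordinary at `2`) and the globally minimal model `A` of its twist `E^K` (good
ordinary at `2`) — over the cyclotomic `ℤ₂`-extension of `ℚ`, where the SAME assembly already holds `X(W/ℚ_∞)`, `X(A/ℚ_∞)` `Λ`-torsion from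
PUB's Kato 17.4 clause (`GVISeed.isTorsion_and_lambda_le_lam_of_kato`).  Since `Sel₀ ≤ Sel_{2^∞}` (tree:
`WeierstrassCurve.fineSelmerInfty_le_selmerInfty`), the Pontryagin transpose is a SURJECTIVE `Λ`-linear map `X ↠ X₀` (tree:
`WeierstrassCurve.FineSelmerDualData.exists_linearMap_ofSelmerDual`, `Sprung2012/SharpFlatSelmerDualRestrictionProofs`, any key), and a
quotient of a torsion module is torsion (`Literature.NumberTheory.EllipticCurves.isTorsion_of_surjective`).  So:

* §1 `fineSelmerDual_isTorsion_of_selmerDual_isTorsion` / `fineSelmerDual_finite_and_isTorsion_of_selmerDual_isTorsion` — `X₀(E/K_∞)`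
  inherits `Λ`-torsion (any key `γ`) from `X(E/K_∞)` (finite generation is the tree theorem `FineSelmerDualData.module_finite`), for
  EVERY elliptic curve over EVERY number field, every `p`, every `ℤ_p`-extension (kernel, 3 lines; stated generally so that the K4
  doors binding `(hYt : Module.IsTorsion Λ Y.X)` next to a cotorsion hypothesis can use them too).
* §2 `thetaShapiroKatoGreenbergSupplyAtTwo_of_inputs_of_pub` = p701530's assembly WITHOUT the binder `hX₀` (the two fine duals are fed by §1
  from `hDt`, `hDAt`), and `thetaShapiroKatoGreenbergSupplyAtTwo_of_print_of_lambdaShapiro` : **4‴ ⟸ FIVE printed named facts {PUB (item 19167), F3-K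
  `Kato2004.exists_zetaClass_colemanMinus_recLaw_index_two`, (12.2.3) `Kato2004.localIwasawaH1_tateRep_moduleFinite`, Kato 12.4 (2)
  `Kato2004.thm12_4`, PT-K `Kato2004.poitouTate_shapiroLattice_bdp_two`} + (S)** — (S) `LambdaShapiroFineAtTwo` being the KERNEL THEOREM
  `TwoAdicShapiroPT.lambdaShapiroFineAtTwo_holds` (p709423; kept as a by-name binder only to keep this file's import cone inside the built
  tree), ORD and X₀-torsion kernel.

So the line reads «19556∣(β) ⟸ 6‴ (research) + PRINT {PUB, FW, F3-K, (12.2.3), Kato 12.4} + READING@2 {PT-K} (+ ORD/(S)/X₀ kernel)»: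
one XL named fact fewer in the trust base of 4‴ (the general-`E` fine-torsion fact stays in the tree for its other consumers; on this
line it was never needed beyond the good-ordinary habitat, where it is a corollary of PUB).

HONEST FRAMING.  THEOREMS ONLY; no definition, no named fact, no instance, no `sorry`; §2 is CONDITIONAL on the five named inputs; the crux
`OrdLambdaHalfAtTwo` is NOT proved here (stub 6‴ `ThetaShapiroGreenbergDivisibilityAtTwo` is research and untouched); BSD is not proved by
any of this.  PARTITION (D-0054): none — RANK axis S3 × X5@2 stratum (β); closes none (the lead closes registered stubs).
-/

set_option linter.dupNamespace false
set_option autoImplicit false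

noncomputable section

open scoped NumberField
open Field IsDedekindDomain WeierstrassCurve CategoryTheory
open Literature.NumberTheory.GaloisRepresentations
open Literature.NumberTheory.EllipticCurves Literature.NumberTheory.EllipticCurves.Kato2004
open Literature.NumberTheory.EllipticCurves.Kato2004.EulerSystemValues

namespace Summit.BirchSwinnertonDyer.BirchSwinnertonDyer.Theorems.TwoAdicThetaSupply

universe u

/-! ## §1 `X₀` inherits torsion and finite generation from `X` (kernel; every number field, every `p`, every key) -/

section FineOfSelmer

variable {K : Type u} [Field K] [NumberField K] (W : WeierstrassCurve K) [W.IsElliptic] {p : ℕ} [Fact p.Prime]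
  (κ : ZpExtension K p) {γ : absoluteGaloisGroup K}

/-- **`X(E/K_∞)` `Λ`-torsion ⟹ `X₀(E/K_∞)` `Λ`-torsion** (every elliptic curve over a number field, every prime `p`, every `ℤ_p`-extension
`κ`, EVERY key `γ`, any Pontryagin-dual data `S` of `Sel_{p^∞}(E/K_∞)` and `Y` of `Sel₀(K_∞, E[p^∞])`): `Sel₀ ≤ Sel_{p^∞}` transposes to a
surjective `Λ`-linear `X ↠ X₀` (`FineSelmerDualData.exists_linearMap_ofSelmerDual`) and a quotient of a torsion module is torsion.
[cite: Kato2004Asterisque, §17.13 (17.13.1) (p. 279)] [cite: GreenbergLNM1716, §1 p. 60] [cite: CoatesSujatha2005, §3] -/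
theorem fineSelmerDual_isTorsion_of_selmerDual_isTorsion (S : W.SelmerDualData κ γ) (Y : W.FineSelmerDualData κ γ)
    (hS : S.IsTorsion) : Module.IsTorsion (IwasawaAlgebra p) Y.X := by
  obtain ⟨πY, hπY, -⟩ := WeierstrassCurve.FineSelmerDualData.exists_linearMap_ofSelmerDual W κ S Y
  exact Literature.NumberTheory.EllipticCurves.isTorsion_of_surjective πY hπY hS

/-- **The consumer shape**: for a topological generator `γ`, `X(E/K_∞)` `Λ`-torsion ⟹ `X₀(E/K_∞)` is a finitely generated torsion
`Λ`-module (finite generation from the tree theorem `FineSelmerDualData.module_finite`, Coates–Sujatha §3; torsion from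
`fineSelmerDual_isTorsion_of_selmerDual_isTorsion`) — exactly the pair `fineSelmerDual_finite_and_isTorsion_of_kato2004 hX₀ …` delivers,
WITHOUT the named fact `Kato2004_fineSelmerDual_isTorsion`, wherever `X` is already known to be torsion (Kato 17.4 at good ordinary /
multiplicative `p`; Mazur's control when `Sel_{p^∞}(E/K)` is finite). [cite: Kato2004Asterisque, Thm 17.4 (1) (p. 273), §17.13 (p. 279)]
[cite: CoatesSujatha2005, §3] -/
theorem fineSelmerDual_finite_and_isTorsion_of_selmerDual_isTorsion (hγ : κ.IsTopGenerator γ) (S : W.SelmerDualData κ γ)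
    (hS : S.IsTorsion) (Y : W.FineSelmerDualData κ γ) :
    Module.Finite (IwasawaAlgebra p) Y.X ∧ Module.IsTorsion (IwasawaAlgebra p) Y.X :=
  ⟨WeierstrassCurve.FineSelmerDualData.module_finite W κ hγ Y, fineSelmerDual_isTorsion_of_selmerDual_isTorsion W κ S Y hS⟩

end FineOfSelmer

/-! ## §2 Stub 4‴ without the X₀-torsion binder -/

open scoped MatrixGroups ModularForm
open CongruenceSubgroup NumberField Literature.NumberTheory.EllipticCurves.ModularForms
open Literature.NumberTheory.EllipticCurves.Rank1Residual
open Summit.BirchSwinnertonDyer.BirchSwinnertonDyer.Theorems.TwoAdicKatoDeterminant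
open Summit.BirchSwinnertonDyer.BirchSwinnertonDyer.Theorems.TwoAdicShapiroPT
open Summit.BirchSwinnertonDyer.BirchSwinnertonDyer.Theorems.TwoAdicShapiroLattice
open Summit.BirchSwinnertonDyer.BirchSwinnertonDyer.Theorems.TwoAdicColemanTransport
open Summit.BirchSwinnertonDyer.Rank1Residual.X1.MuLambda (lam)
open Summit.BirchSwinnertonDyer.Rank1Residual.X11b (AcSelmer.bdpData AcSelmer.strictDatum)

/-- **STUB 4‴ `ThetaShapiroKatoGreenbergSupplyAtTwo` ⟸ SIX NAMED INPUTS, no X₀-torsion fact** (= p701530's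
`thetaShapiroKatoGreenbergSupplyAtTwo_of_inputs` with the binder `hX₀ : Kato2004_fineSelmerDual_isTorsion` REMOVED).  Inputs: [PUB]
`OrdConversePublishedInputsAtTwo` (item 19167 = the line's `stub_pub`; only Kato 17.4 at `2` is used: `X(W/ℚ_∞)`, `X(A/ℚ_∞)` torsion —
and NOW ALSO, through §1, `X₀(W/ℚ_∞)`, `X₀(A/ℚ_∞)` finitely generated torsion) · [F3-K] `Kato2004.exists_zetaClass_colemanMinus_recLaw_index_two` ·
[ORD] `Kato2004.tateModuleFilAt_inertia_ordinary` · [(12.2.3)] `Kato2004.localIwasawaH1_tateRep_moduleFinite` · [(S)] `LambdaShapiroFineAtTwo` ·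
[(PT)] `ShapiroLatticePoitouTateAtTwoTheta`.  The assembly is p701530's, verbatim except for the two fine-dual lines.  CONDITIONAL on the six
inputs; the crux is NOT proved here. [cite: Kato2004Asterisque, Thm 12.5, Thm 17.4 (1), §17.13, Thm 16.6, Prop 17.11]
[cite: GreenbergLNM1716, §2 (pp. 62–64)] [cite: GreenbergVatsal2000, §2] -/
theorem thetaShapiroKatoGreenbergSupplyAtTwo_of_inputs_of_pub
    (hPub : Literature.Uncategorized.OrdConversePublishedInputsAtTwo)
    (hF3K : Kato2004.exists_zetaClass_colemanMinus_recLaw_index_two)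
    (hOrd : Kato2004.tateModuleFilAt_inertia_ordinary)
    (hHl : Kato2004.localIwasawaH1_tateRep_moduleFinite)
    (hS : LambdaShapiroFineAtTwo) (hPT : ShapiroLatticePoitouTateAtTwoTheta) :
    ThetaShapiroKatoGreenbergSupplyAtTwo := by
  intro W _ _ hCM hGO hβ κ γ hκ hγ hγ' hord _ f hf D L₀ hL₀ K _ _ hK A _ _ C hA hordA _ g hg DA L₀' hL₀' w hw κK γK hκK hγK
    DGr Dfi hcot _ _
  obtain ⟨-, hKato, -⟩ := hPub
  -- the place `2`, a local lift of the generator, the pins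
  obtain ⟨v, hv⟩ : ∃ v : HeightOneSpectrum (𝓞 ℚ), ((2 : ℕ) : 𝓞 ℚ) ∈ v.asIdeal := by
    have hne : Ideal.span {((2 : ℕ) : 𝓞 ℚ)} ≠ ⊤ := by
      rw [Ne, Ideal.span_singleton_eq_top]
      intro h
      have h2 : IsUnit ((2 : ℕ) : ℤ) := by
        have := h.map (Rat.IsIntegralClosure.intEquiv (𝓞 ℚ))
        rwa [map_natCast] at this
      exact absurd (Int.isUnit_iff.mp h2) (by norm_num)
    obtain ⟨M, hM, hle⟩ := Ideal.exists_le_maximal _ hne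
    have hM0 : M ≠ ⊥ := by
      intro h0
      rw [h0, le_bot_iff, Ideal.span_singleton_eq_bot] at hle
      exact two_ne_zero (by exact_mod_cast hle)
    exact ⟨⟨M, hM.isPrime, hM0⟩, hle (Ideal.mem_span_singleton_self _)⟩
  obtain ⟨γᵥ, hγᵥ⟩ := hκ.exists_isTopGenerator_resGalOfEmb_adicCompletion v hv
  have hsurj : Function.Surjective
      (κ.toContinuousMonoidHom.comp (resGalOfEmb (closureEmb (K := ℚ) (v.adicCompletion ℚ)))) := fun t ↦ by
    obtain ⟨g₀, -, hg₀⟩ := hκ.exists_mem_absInertia_apply_resGalOfEmb_adicCompletion_eq v hv t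
    exact ⟨g₀, hg₀⟩
  obtain ⟨I_W⟩ := Kato2004.nonempty_iwasawaH1Data_holds W 2 κ γ hκ hγ
  obtain ⟨I_A⟩ := Kato2004.nonempty_iwasawaH1Data_holds A 2 κ γ hκ hγ
  obtain ⟨J⟩ := nonempty_localIwasawaH1Data κ v ((tateRep W 2).toLocal v) γᵥ
  obtain ⟨J'⟩ := nonempty_localIwasawaH1Data κ v (tateLocalOrdinaryRep W 2 v) γᵥ
  obtain ⟨J_A⟩ := nonempty_localIwasawaH1Data κ v ((tateRep A 2).toLocal v) γᵥ
  have hH2 : SatisfiesHeegnerHypothesis 2 K := hK.2.of_dvd (dvd_mul_right 2 _)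
  -- (PT): the local untwisting, the Shapiro lattice, the re-keyed Poitou–Tate triple, loc-injectivity
  obtain ⟨uA, hbij, L, hle, h2L, ⟨θ, θ_C, δ, π, hδ, hπ, hex⟩, hinj⟩ :=
    hPT W K hK.1 hH2 A C hA w hw κ γ hκ hγ κK γK hκK hγK v hv γᵥ hsurj hγᵥ I_W I_A J J_A DGr Dfi
  -- Kato per curve, read on W's carrier
  obtain ⟨col, zW, zA, uW, uA', nW, nA, hker, hcoker, hrecW, hrecA, htW, htA, hidxW, hidxA⟩ :=
    exists_colemanMinus_recLaws hF3K hOrd f hf hord g hg hordA κ γ hκ hγ hγ' L₀ hL₀ L₀' hL₀' v hv γᵥ hsurj hγᵥ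
      I_W I_A J J' J_A uA hbij
  -- torsion / finiteness of the cyclotomic duals (Kato 17.4 = PUB), fine duals over `ℚ_∞` BY §1 (no X₀ fact)
  have hL₀0 : L₀ ≠ 0 := by
    rintro rfl; exact padicLFunction_unitRoot_ne_zero hord hf (by rw [← hL₀, map_zero])
  have hL₀'0 : L₀' ≠ 0 := by
    rintro rfl; exact padicLFunction_unitRoot_ne_zero hordA hg (by rw [← hL₀', map_zero])
  have hL₀1 : iwasawaToPowerSeries 2 L₀ = PowerSeries.C ((1 : ℚ) : ℚ_[2]) * padicLFunction f (unitRoot W 2 : ℚ_[2]) := by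
    rw [hL₀, Rat.cast_one, map_one, one_mul]
  have hL₀'1 : iwasawaToPowerSeries 2 L₀' = PowerSeries.C ((1 : ℚ) : ℚ_[2]) * padicLFunction g (unitRoot A 2 : ℚ_[2]) := by
    rw [hL₀', Rat.cast_one, map_one, one_mul]
  obtain ⟨hDt, -⟩ := Summit.BirchSwinnertonDyer.BirchSwinnertonDyer.Theorems.GVISeed.isTorsion_and_lambda_le_lam_of_kato W
    (hKato W f) hκ hγ hγ' hord hf D one_ne_zero hL₀1 hL₀0
  obtain ⟨hDAt, -⟩ := Summit.BirchSwinnertonDyer.BirchSwinnertonDyer.Theorems.GVISeed.isTorsion_and_lambda_le_lam_of_kato A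
    (hKato A g) hκ hγ hγ' hordA hg DA one_ne_zero hL₀'1 hL₀'0
  have hDfin : Module.Finite (IwasawaAlgebra 2) D.X := D.module_finite_holds hγ
  have hDAfin : Module.Finite (IwasawaAlgebra 2) DA.X := DA.module_finite_holds hγ
  obtain ⟨Y_W⟩ := W.nonempty_fineSelmerDualData κ hγ
  obtain ⟨Y_A⟩ := A.nonempty_fineSelmerDualData κ hγ
  have hYW := fineSelmerDual_finite_and_isTorsion_of_selmerDual_isTorsion W κ hγ D hDt Y_W
  have hYA := fineSelmerDual_finite_and_isTorsion_of_selmerDual_isTorsion A κ hγ DA hDAt Y_A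
  -- (S)
  obtain ⟨-, hlamS⟩ := hS W K hK.1 hH2 A C hA κ γ hκ hγ κK γK hκK hγK Y_W Y_A Dfi hYW.1 hYW.2 hYA.1 hYA.2
  have hiW := hidxW D Y_W hDfin hDt
  have hiA := hidxA DA Y_A hDAfin hDAt
  have hbW := PinnedKatoGreenbergDatum.lambdaInvariant_quotient_span_singleton_eq_lam hL₀0
  have hbA := PinnedKatoGreenbergDatum.lambdaInvariant_quotient_span_singleton_eq_lam hL₀'0
  refine ⟨v, γᵥ, hsurj, hγᵥ, I_W, I_A, J, J', J_A, uA, ⟨{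
    two_mem := hv
    uA_bijective := hbij
    colMinus := col
    colMinus_ker := hker
    colMinus_coker := hcoker
    zW := zW
    zA := zA
    nW := nW
    nA := nA
    unitW := uW
    unitA := uA'
    recW := hrecW
    recA := hrecA
    finiteHl := hHl W 2 κ v γᵥ hκ hv hγᵥ J
    loc_injective := hinj hcot.1 hcot.2
    isTorsion_quot := PinnedKatoCore.isTorsion_quot_of_poitouTate_semilinear zW zA htW htA L h2L θ δ hδ hcot.2
    L := L
    range_le := hle
    two_smul_mem := h2L
    θ := θ
    θ_C := θ_C
    δ := δ
    δ_injective := hδ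
    π := π
    π_surjective := hπ
    exact_δ_π := hex
    katoIndex := ?_ }⟩⟩
  change lambdaInvariant 2 _ + lambdaInvariant 2 _ + (lambdaInvariant 2 D.X + lambdaInvariant 2 DA.X) = _
  omega

/-- **STUB 4‴ FROM FIVE PRINTED NAMED FACTS + (S)** (the X₀-torsion fact of p702717/p709423's `…_of_print` / `…_of_print'` is no
longer an input): `ThetaShapiroKatoGreenbergSupplyAtTwo` from [PUB] `OrdConversePublishedInputsAtTwo` (item 19167), [F3-K]
`Kato2004.exists_zetaClass_colemanMinus_recLaw_index_two`, [(12.2.3)] `Kato2004.localIwasawaH1_tateRep_moduleFinite`, [Kato 12.4 (2)]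
`Kato2004.thm12_4`, [PT-K] `Kato2004.poitouTate_shapiroLattice_bdp_two`, and the λ-Shapiro statement (S) `LambdaShapiroFineAtTwo` — a KERNEL
THEOREM since p709423 (`TwoAdicShapiroPT.lambdaShapiroFineAtTwo_holds`, file `…LambdaShapiroFine`; kept as a binder here only so that this
file does not import that one: feed it by name).  ORD (`Kato2004.tateModuleFilAt_inertia_ordinary_holds`, audit-2 p701851), (PT)
(`shapiroLatticePoitouTateAtTwoTheta_of_facts`, p702717) and X₀-torsion (§1) are kernel.  So, for the skeleton:
`stub_thetaShapiroKatoGreenbergSupplyAtTwo := thetaShapiroKatoGreenbergSupplyAtTwo_of_print_of_lambdaShapiro stub_pub hF3K hHl h124 hPTK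
lambdaShapiroFineAtTwo_holds` — 4‴ ⟸ FIVE print stubs.  CONDITIONAL on the five facts (+ (S)); the crux is NOT proved here; BSD is not
proved by any of this. [cite: Kato2004Asterisque, Thm 12.4, 12.5, 16.6, 17.4 (1), Prop 17.11, §17.13] [cite: Nekovar2006, 8.9.6.1–8.9.6.2 (p. 240)]
[cite: GreenbergLNM1716, §2, §4 p. 107] -/
theorem thetaShapiroKatoGreenbergSupplyAtTwo_of_print_of_lambdaShapiro
    (hPub : Literature.Uncategorized.OrdConversePublishedInputsAtTwo)
    (hF3K : Kato2004.exists_zetaClass_colemanMinus_recLaw_index_two)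
    (hHl : Kato2004.localIwasawaH1_tateRep_moduleFinite)
    (h124 : Kato2004.thm12_4)
    (hPTK : Kato2004.poitouTate_shapiroLattice_bdp_two)
    (hS : LambdaShapiroFineAtTwo) :
    ThetaShapiroKatoGreenbergSupplyAtTwo :=
  thetaShapiroKatoGreenbergSupplyAtTwo_of_inputs_of_pub hPub hF3K Kato2004.tateModuleFilAt_inertia_ordinary_holds hHl hS
    (shapiroLatticePoitouTateAtTwoTheta_of_facts h124 hPTK)

end Summit.BirchSwinnertonDyer.BirchSwinnertonDyer.Theorems.TwoAdicThetaSupply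

end
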